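import Summits.CriticalPhenomena.SAWScalingLimit.Theorems.TubeLowerBound.Negative.TubeLowerBoundLoadBearing
import Literature.Probability.RandomPlanarGeometry.SAWPatternTheorem

/-!
# Negative knowledge on crux `TubeLowerBound` (stmt-CriticalPhenomena-4730), part 2: fixed-width tubes decay exponentially; criticality is load-bearing

Refuter `cdisprove`; work file `Summits/CriticalPhenomena/SAWScalingLimit/Cruxes/TubeLowerBound/Disproof.lean`.
All PROVED:

* `tubeMass_le_geom` — a geometric-tail bound for tube masses;
* `not_withoutDist` — the aspect-ratio coupling `|u - v| ≤ ℓ` of the crux is load-bearing: at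
  `ℓ = 1` along the diagonal `v = (L, L)` the tube lies in the band `|x - y| ≤ 2` (`band_of_tube`),
  where Kesten's pattern `V = N³ESENES³` cannot occur (`not_occV_of_band`), so the in-tree pattern
  theorem `SAW.Zd.thm723` (Madras–Slade Thm 7.2.3) bounds the confined counts by `((1-ε)μ)^n` and
  the critical tube mass by `(1-ε)^L/ε → 0` — a tube of FIXED width is exponentially subcritical
  at `x_c`; only the widening `ℓ/10` can make the floor polynomial;
* `not_atFugacity_of_lt` — for every `0 ≤ x < x_c` the floor fails (`c_n^{1/n} → μ`), so any proof
  must use `x = x_c` exactly.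
-/

noncomputable section

namespace Summit.CriticalPhenomena.SAWScalingLimit.Theorems.TubeLowerBound.Negative

open Literature.Probability.LatticeModels Literature.Probability.RandomPlanarGeometry
open Literature.Probability.RandomPlanarGeometry.SAW
open Summit.CriticalPhenomena.SAWScalingLimit.Theses.SAWRenewalTightness (TubeLowerBound)
open Filter Topology
open scoped BigOperators

/-! ### A geometric-tail bound for tube masses -/

open Classical in
/-- If the confined counts of length `n ≥ L` weighted by `x^n` are `≤ θ^n` and no walk of length
`< L` reaches `v`, then every partial tube mass is `≤ θ^L / (1 - θ)`. [folklore] -/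
theorem tubeMass_le_geom {x θ : ℝ} (hθ0 : 0 ≤ θ) (hθ1 : θ < 1) {u v : Site 2} {r : ℝ}
    {L : ℕ}
    (hcard : ∀ n, L ≤ n → (((Zd.sawFun 2 n (v - u)).filter (fun ω => ∀ i ≤ n,
      Metric.infDist (Site.toComplex (u + ω i)) (segment ℝ (Site.toComplex u) (Site.toComplex v))
        ≤ r)).card : ℝ) * x ^ n ≤ θ ^ n)
    (hempty : ∀ n, n < L → Zd.sawFun 2 n (v - u) = ∅) (N : ℕ) :
    tubeMass x u v r N ≤ θ ^ L / (1 - θ) := by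
  unfold tubeMass
  have step : ∀ n ∈ Finset.range (N + 1), (∑ _ω ∈ (Zd.sawFun 2 n (v - u)).filter (fun ω => ∀ i ≤ n,
      Metric.infDist (Site.toComplex (u + ω i)) (segment ℝ (Site.toComplex u) (Site.toComplex v))
        ≤ r), x ^ n) ≤ if L ≤ n then θ ^ n else 0 := by
    intro n _
    rw [Finset.sum_const, nsmul_eq_mul]
    split_ifs with hLn
    · exact hcard n hLn
    · rw [hempty n (not_le.1 hLn), Finset.filter_empty, Finset.card_empty, Nat.cast_zero, zero_mul]
  refine (Finset.sum_le_sum step).trans ?_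
  rw [← Finset.sum_filter]
  calc ∑ n ∈ (Finset.range (N + 1)).filter (fun n => L ≤ n), θ ^ n
      ≤ ∑ n ∈ Finset.Ico L (N + 1), θ ^ n := by
        refine Finset.sum_le_sum_of_subset_of_nonneg ?_ (fun _ _ _ => pow_nonneg hθ0 _)
        intro n hn
        simp only [Finset.mem_filter, Finset.mem_range] at hn
        exact Finset.mem_Ico.2 ⟨hn.2, hn.1⟩
    _ ≤ θ ^ L / (1 - θ) := geom_sum_Ico_le_of_lt_one hθ0 hθ1

/-! ### (a, continued) The aspect-ratio coupling `|u - v| ≤ ℓ` is load-bearing (Kesten's pattern theorem) -/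

/-- The diagonal lattice point `(L, L)`. [folklore] -/
def diag (L : ℕ) : Site 2 := ![(L : ℤ), (L : ℤ)]

/-- `Site.toComplex (diag L) = L + iL`. [folklore] -/
theorem toComplex_diag (L : ℕ) : Site.toComplex (diag L) = ⟨L, L⟩ := by
  apply Complex.ext <;> simp [Site.toComplex, diag]

/-- **Tube ⇒ diagonal band.** A lattice point within `1/10 + 2` of the diagonal segment
`[0, (L,L)]` has `|x - y| ≤ 2`: `(x - y)² ≤ 2·dist² < 2·(2.12)² < 9`. [folklore] -/
theorem band_of_tube {L : ℕ} {p : Site 2}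
    (h : Metric.infDist (Site.toComplex p)
      (segment ℝ (Site.toComplex (0 : Site 2)) (Site.toComplex (diag L))) ≤ 1 / 10 + 2) :
    |p 0 - p 1| ≤ 2 := by
  have toComplex_zero : Site.toComplex (0 : Site 2) = 0 := by
    apply Complex.ext <;> simp [Site.toComplex]
  have hne : (segment ℝ (Site.toComplex (0 : Site 2)) (Site.toComplex (diag L))).Nonempty :=
    ⟨_, left_mem_segment ℝ _ _⟩
  obtain ⟨y, hy, hdy⟩ := (Metric.infDist_lt_iff hne).1
    (lt_of_le_of_lt h (by norm_num : (1 : ℝ) / 10 + 2 < 212 / 100))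
  rw [toComplex_zero, toComplex_diag] at hy
  obtain ⟨a, b, -, -, -, rfl⟩ := hy
  have hd0 := dist_nonneg (x := Site.toComplex p) (y := a • (0 : ℂ) + b • (⟨L, L⟩ : ℂ))
  have hsq : dist (Site.toComplex p) (a • (0 : ℂ) + b • (⟨L, L⟩ : ℂ)) ^ 2 < (212 / 100) ^ 2 := by
    nlinarith
  rw [Complex.dist_eq, Complex.sq_norm, Complex.normSq_apply] at hsq
  simp only [Complex.sub_re, Complex.sub_im, smul_zero, zero_add,
    Complex.smul_re, Complex.smul_im, smul_eq_mul, Site.toComplex_re, Site.toComplex_im] at hsq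
  have h9 : (((p 0 : ℤ) : ℝ) - ((p 1 : ℤ) : ℝ)) ^ 2 < 9 := by
    nlinarith [sq_nonneg (((p 0 : ℤ) : ℝ) - b * L + (((p 1 : ℤ) : ℝ) - b * L))]
  have h9' : ((p 0 - p 1 : ℤ) : ℝ) ^ 2 < 9 := by push_cast; exact h9
  have h9'' : (p 0 - p 1) ^ 2 < 9 := by exact_mod_cast h9'
  have h1 : p 0 - p 1 < 3 := by nlinarith [sq_nonneg (p 0 - p 1 + 3)]
  have h2 : -3 < p 0 - p 1 := by nlinarith [sq_nonneg (p 0 - p 1 - 3)]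
  rw [abs_le]
  omega

/-- **No occurrence of Kesten's pattern `V` inside the band.** `V = N³ESENES³` (Madras–Slade
Fig. 7.4, in the tree's fixed orientation `Zd.OccV`) passes through `ω(k) + (0,3)` and
`ω(k) + (3,0)`, whose values of `x - y` differ by `6`; a walk whose vertices all satisfy
`|x - y| ≤ 2` (five consecutive values) therefore has no occurrence of `(V, Q)`.
[cite: MadrasSlade1993, Definition 7.2.2 and Theorem 7.3.2 (Fig. 7.4)] -/
theorem not_occV_of_band {n : ℕ} {ω : ℕ → Site 2} (hband : ∀ i ≤ n, |ω i 0 - ω i 1| ≤ 2)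
    (k : ℕ) : ¬ Zd.OccV n ω k := by
  rintro ⟨hk, hseg, -⟩
  have e3 : (Zd.vPt 3 : Site 2) = Zd.mk2 0 3 := by simp [Zd.vPt, Zd.vCoord]
  have e11 : (Zd.vPt 11 : Site 2) = Zd.mk2 3 0 := by simp [Zd.vPt, Zd.vCoord]
  have a := hband (k + 3) (by omega)
  have b := hband (k + 11) (by omega)
  rw [hseg 3 (by norm_num), e3] at a
  rw [hseg 11 le_rfl, e11] at b
  simp only [Pi.add_apply, Zd.mk2_apply_zero, Zd.mk2_apply_one] at a b
  rw [abs_le] at a b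
  omega

/-- **The coupling `|u - v| ≤ ℓ` is load-bearing.** Fix `ℓ = 1` (tube radius `21/10`) and let
`v = (L, L)` run along the diagonal: the tube sits inside the band `|x - y| ≤ 2` (`band_of_tube`),
confined walks have no occurrence of Kesten's pattern `V` (`not_occV_of_band`), so by the
in-tree pattern theorem `Zd.thm723` (Madras–Slade Thm 7.2.3 for `(V,Q)`) at most `((1-ε)μ)^n`
of them have length `n ≥ N₀`; with `x_c μ = 1` the critical tube mass is `≤ (1-ε)^L / ε → 0`,
against the constant floor `c · 1^{-C} = c`.  Moral for provers: in a tube of FIXED width the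
critical mass decays exponentially in the length (the strip is strictly subcritical at `x_c`);
only the widening `ℓ/10` can make the floor polynomial, i.e. the proof must see that a strip of
width `w` at `x_c` has correlation length `≳ w / log w` — an RSW-type input.
[cite: MadrasSlade1993, Theorem 7.2.3] -/
theorem not_withoutDist : ¬ (∃ C c : ℝ, 0 < c ∧ ∀ (u v : Site 2) (ℓ : ℝ), 1 ≤ ℓ →
    ∃ N : ℕ, c * ℓ ^ (-C) ≤ tubeMass criticalFugacity u v (ℓ / 10 + 2) N) := by
  classical
  rintro ⟨C, c, hc, h⟩
  obtain ⟨q, -, ε, hε0, hε1, N₀, hb⟩ := Zd.thm723 0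
  have hb' : ∀ n, N₀ ≤ n →
      (((Zd.saws 2 n).filter fun ω => Zd.vCount n ω ≤ n / q).card : ℝ) ≤
        ((1 - ε) * Zd.connectiveConstant 2) ^ n := hb
  -- choose the distance `L ≥ N₀` with `(1-ε)^L < c ε`
  obtain ⟨L, hL0, hL⟩ : ∃ L : ℕ, N₀ ≤ L ∧ (1 - ε) ^ L < c * ε := by
    have ht : Tendsto (fun n : ℕ => (1 - ε) ^ n) atTop (𝓝 0) :=
      tendsto_pow_atTop_nhds_zero_of_lt_one (by linarith) (by linarith)
    exact ((eventually_ge_atTop N₀).and (ht.eventually (gt_mem_nhds (mul_pos hc hε0)))).exists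
  obtain ⟨N, hN⟩ := h 0 (diag L) 1 le_rfl
  rw [Real.one_rpow, mul_one] at hN
  have hμ : 0 < Zd.connectiveConstant 2 := Zd.connectiveConstant_pos 2
  have hxμ : (1 - ε) * Zd.connectiveConstant 2 * criticalFugacity = 1 - ε := by
    rw [show criticalFugacity = (Zd.connectiveConstant 2)⁻¹ from rfl, mul_assoc,
      mul_inv_cancel₀ hμ.ne', mul_one]
  have hmass : tubeMass criticalFugacity 0 (diag L) (1 / 10 + 2) N ≤ (1 - ε) ^ L / (1 - (1 - ε)) := by
    refine tubeMass_le_geom (by linarith) (by linarith) (fun n hn => ?_) (fun n hn => ?_) N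
    · -- confined walks of length `n ≥ L ≥ N₀` are `V`-free, hence few
      have hsub : (Zd.sawFun 2 n (diag L - 0)).filter (fun ω => ∀ i ≤ n,
          Metric.infDist (Site.toComplex (0 + ω i))
            (segment ℝ (Site.toComplex 0) (Site.toComplex (diag L))) ≤ 1 / 10 + 2) ⊆
          (Zd.saws 2 n).filter fun ω => Zd.vCount n ω ≤ n / q := by
        intro ω hω
        rw [Finset.mem_filter] at hω ⊢
        obtain ⟨hω, htube⟩ := hω
        refine ⟨(Zd.mem_sawFun_iff_mem_saws.1 hω).1, ?_⟩
        have hband : ∀ i ≤ n, |ω i 0 - ω i 1| ≤ 2 := fun i hi => by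
          have := htube i hi
          rw [zero_add] at this
          exact band_of_tube this
        have h0 : Zd.vCount n ω = 0 := by
          unfold Zd.vCount Zd.vSites
          rw [Finset.card_eq_zero, Finset.filter_eq_empty_iff]
          exact fun k _ => not_occV_of_band hband k
        rw [h0]
        exact Nat.zero_le _
      have hcard := Finset.card_le_card hsub
      calc (((Zd.sawFun 2 n (diag L - 0)).filter (fun ω => ∀ i ≤ n,
            Metric.infDist (Site.toComplex (0 + ω i))
              (segment ℝ (Site.toComplex 0) (Site.toComplex (diag L))) ≤ 1 / 10 + 2)).card : ℝ) *
              criticalFugacity ^ n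
          ≤ ((1 - ε) * Zd.connectiveConstant 2) ^ n * criticalFugacity ^ n := by
            refine mul_le_mul_of_nonneg_right ?_ (pow_nonneg criticalFugacity_pos.le _)
            exact le_trans (by exact_mod_cast hcard) (hb' n (hL0.trans hn))
        _ = (1 - ε) ^ n := by rw [← mul_pow, hxμ]
    · -- no walk shorter than `L` reaches `(L, L)`
      refine Finset.eq_empty_of_forall_notMem fun ω hω => ?_
      have := le_of_mem_sawFun hω 0
      simp [diag] at this
      omega
  rw [show (1 : ℝ) - (1 - ε) = ε by ring] at hmass
  have : (1 - ε) ^ L / ε < c := by rwa [div_lt_iff₀ hε0]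
  linarith

/-! ### (a, continued) Criticality is load-bearing: the floor fails at every `x < x_c` -/

/-- The axis lattice point `(L, 0)`. [folklore] -/
def axisPt (L : ℕ) : Site 2 := ![(L : ℤ), 0]

/-- `Site.toComplex (axisPt L) = L`. [folklore] -/
theorem toComplex_axisPt (L : ℕ) : Site.toComplex (axisPt L) = (L : ℂ) := by
  apply Complex.ext <;> simp [Site.toComplex, axisPt]

/-- **Criticality is load-bearing**: for every fugacity `0 ≤ x < x_c` the floor fails, because the
whole (unconfined) two-point mass `Σ_{n ≥ L} c_n x^n` beyond distance `L` is `≤ θ^L/(1-θ)` with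
`θ = x(1+η)μ < 1` (`c_n ≤ ((1+η)μ)^n` eventually, from `c_n^{1/n} → μ`), which is eventually
below any polynomial `c L^{-C}`.  So any proof must use `x = x_c` exactly (for `x > x_c` the floor
only gets easier; the barrier `SupercriticalSAWSpaceFilling` concerns upper bounds and does not
bite). [cite: MadrasSlade1993, §1.2, (1.2.9)] -/
theorem not_atFugacity_of_lt {x : ℝ} (hx0 : 0 ≤ x) (hx : x < criticalFugacity) :
    ¬ (∃ C c : ℝ, 0 < c ∧ ∀ (u v : Site 2) (ℓ : ℝ), 1 ≤ ℓ →
      dist (Site.toComplex u) (Site.toComplex v) ≤ ℓ →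
        ∃ N : ℕ, c * ℓ ^ (-C) ≤ tubeMass x u v (ℓ / 10 + 2) N) := by
  classical
  rintro ⟨C, c, hc, h⟩
  have toComplex_zero : Site.toComplex (0 : Site 2) = 0 := by
    apply Complex.ext <;> simp [Site.toComplex]
  have hμ : 0 < Zd.connectiveConstant 2 := Zd.connectiveConstant_pos 2
  have hxc : criticalFugacity = (Zd.connectiveConstant 2)⁻¹ := rfl
  -- `θ = x (1+η) μ < 1` for `η` small
  have hxμ : x * Zd.connectiveConstant 2 < 1 := by
    rw [hxc] at hx
    calc x * Zd.connectiveConstant 2 < (Zd.connectiveConstant 2)⁻¹ * Zd.connectiveConstant 2 :=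
          mul_lt_mul_of_pos_right hx hμ
      _ = 1 := inv_mul_cancel₀ hμ.ne'
  obtain ⟨η, hη, hθ1⟩ : ∃ η : ℝ, 0 < η ∧ x * ((1 + η) * Zd.connectiveConstant 2) < 1 := by
    rcases eq_or_lt_of_le hx0 with rfl | hxpos
    · exact ⟨1, one_pos, by simp⟩
    · have hpos : 0 < x * Zd.connectiveConstant 2 := mul_pos hxpos hμ
      refine ⟨(1 - x * Zd.connectiveConstant 2) / (2 * (x * Zd.connectiveConstant 2)), by
        apply div_pos <;> linarith, ?_⟩
      have : x * ((1 + (1 - x * Zd.connectiveConstant 2) / (2 * (x * Zd.connectiveConstant 2))) *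
          Zd.connectiveConstant 2) = (x * Zd.connectiveConstant 2 + 1) / 2 := by
        field_simp
        ring
      rw [this]
      linarith
  set θ := x * ((1 + η) * Zd.connectiveConstant 2) with hθ
  have hθ0 : 0 ≤ θ := mul_nonneg hx0 (by positivity)
  -- `c_n x^n ≤ θ^n` for `n ≥ N₁`
  have hlt : Zd.connectiveConstant 2 < (1 + η) * Zd.connectiveConstant 2 := by nlinarith
  obtain ⟨N₁, hN₁⟩ := eventually_atTop.1 ((Zd.tendsto_count_rpow 2).eventually (gt_mem_nhds hlt))
  have hcount : ∀ n, N₁ ≤ n → 1 ≤ n → (Zd.count 2 n : ℝ) * x ^ n ≤ θ ^ n := by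
    intro n hn hn1
    have hcn := hN₁ n hn
    have hc0 : 0 ≤ (Zd.count 2 n : ℝ) := by positivity
    have hn0 : (n : ℝ) ≠ 0 := by exact_mod_cast (show n ≠ 0 by omega)
    have e : (Zd.count 2 n : ℝ) = ((Zd.count 2 n : ℝ) ^ (1 / (n : ℝ))) ^ n := by
      rw [← Real.rpow_natCast, ← Real.rpow_mul hc0, one_div_mul_cancel hn0, Real.rpow_one]
    rw [e, hθ, mul_comm x, mul_pow]
    exact mul_le_mul_of_nonneg_right (pow_le_pow_left₀ (by positivity) hcn.le n) (pow_nonneg hx0 _)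
  -- a natural exponent `K ≥ C`, and `L` large: `L ≥ N₁`, `L ≥ 1`, `L^K θ^L < c (1 - θ)`
  obtain ⟨K, hK⟩ : ∃ K : ℕ, C ≤ K := exists_nat_ge C
  have hlim : Tendsto (fun n : ℕ => (n : ℝ) ^ K * θ ^ n) atTop (𝓝 0) :=
    tendsto_pow_const_mul_const_pow_of_abs_lt_one K (by rw [abs_of_nonneg hθ0]; exact hθ1)
  obtain ⟨L, hL1, hLN, hL⟩ : ∃ L : ℕ, 1 ≤ L ∧ N₁ ≤ L ∧ (L : ℝ) ^ K * θ ^ L < c * (1 - θ) := by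
    obtain ⟨L, ⟨h1, h2⟩, h3⟩ := (((eventually_ge_atTop 1).and (eventually_ge_atTop N₁)).and
      (hlim.eventually (gt_mem_nhds (mul_pos hc (sub_pos.2 hθ1))))).exists
    exact ⟨L, h1, h2, h3⟩
  have hLpos : (0 : ℝ) < L := by exact_mod_cast hL1
  -- the floor at `u = 0`, `v = (L, 0)`, `ℓ = L`
  obtain ⟨N, hN⟩ := h 0 (axisPt L) L (by exact_mod_cast hL1)
    (by rw [toComplex_zero, toComplex_axisPt]; simp)
  -- upper bound on the mass: drop the tube, keep only `n ≥ L`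
  have hmass : tubeMass x 0 (axisPt L) ((L : ℝ) / 10 + 2) N ≤ θ ^ L / (1 - θ) := by
    refine tubeMass_le_geom hθ0 hθ1 (fun n hn => ?_) (fun n hn => ?_) N
    · calc (((Zd.sawFun 2 n (axisPt L - 0)).filter (fun ω => ∀ i ≤ n,
            Metric.infDist (Site.toComplex (0 + ω i))
              (segment ℝ (Site.toComplex 0) (Site.toComplex (axisPt L))) ≤ (L : ℝ) / 10 + 2)).card : ℝ) *
              x ^ n
          ≤ (Zd.count 2 n : ℝ) * x ^ n := by
            refine mul_le_mul_of_nonneg_right ?_ (pow_nonneg hx0 _)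
            have h1 := Finset.card_le_card (Finset.filter_subset (fun ω => ∀ i ≤ n,
              Metric.infDist (Site.toComplex (0 + ω i))
                (segment ℝ (Site.toComplex 0) (Site.toComplex (axisPt L))) ≤ (L : ℝ) / 10 + 2)
              (Zd.sawFun 2 n (axisPt L - 0)))
            have h2 : (Zd.sawFun 2 n (axisPt L - 0)).card ≤ Zd.count 2 n := by
              rw [← Zd.card_saws]
              exact Finset.card_le_card fun ω hω => (Zd.mem_sawFun_iff_mem_saws.1 hω).1
            exact_mod_cast h1.trans h2
        _ ≤ θ ^ n := hcount n (hLN.trans hn) (hL1.trans hn)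
    · refine Finset.eq_empty_of_forall_notMem fun ω hω => ?_
      have := le_of_mem_sawFun hω 0
      simp [axisPt] at this
      omega
  -- lower bound: `c L^{-C} ≥ c L^{-K} = c / L^K`
  have hfloor : c / (L : ℝ) ^ K ≤ c * (L : ℝ) ^ (-C) := by
    rw [div_eq_mul_inv, ← Real.rpow_natCast, ← Real.rpow_neg hLpos.le]
    refine mul_le_mul_of_nonneg_left ?_ hc.le
    exact Real.rpow_le_rpow_of_exponent_le (by exact_mod_cast hL1) (by linarith)
  have hLK : (0 : ℝ) < (L : ℝ) ^ K := pow_pos hLpos K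
  have key : θ ^ L / (1 - θ) < c / (L : ℝ) ^ K := by
    rw [div_lt_div_iff₀ (by linarith) hLK]
    nlinarith
  linarith

/-- Sanity link: at `x = x_c` the statement refuted above for `x < x_c` is literally the crux
(so `not_atFugacity_of_lt` cannot be pushed to `x_c` without settling the crux negatively). [folklore] -/
theorem atCriticalFugacity_iff :
    (∃ C c : ℝ, 0 < c ∧ ∀ (u v : Site 2) (ℓ : ℝ), 1 ≤ ℓ →
      dist (Site.toComplex u) (Site.toComplex v) ≤ ℓ →
        ∃ N : ℕ, c * ℓ ^ (-C) ≤ tubeMass criticalFugacity u v (ℓ / 10 + 2) N) ↔ TubeLowerBound :=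
  Iff.rfl

end Summit.CriticalPhenomena.SAWScalingLimit.Theorems.TubeLowerBound.Negative
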